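import Summits.AtomisticToContinuum.BoseEinsteinCondensation.Theorems.BECSwapNoCatastropheDefs
import Literature.MathematicalPhysics.QuantumManyBody.PeriodicBoseGasJastrow
import Literature.MathematicalPhysics.QuantumManyBody.PeriodicSmoothPairCutoff
import HarnessLib

/-!
# Crux `TorusHalfSwapOverlap` (stmt-AtomisticToContinuum-14393), line `birth`, stub `stub_upperFrameHardCore` (S7),
# part A: the smooth periodic cross cut-off

Route `BECSwapNoCatastrophe` (sub-problem `BoseEinsteinCondensation`), lead c6 (2026-08-17). First of four files
proving the HARD-CORE UPPER FRAME `inf_{Adm0} E2(½) ≤ 2 E₀^per(n+1, L) + C n L⁻³`. Cut-off calculus for a `C¹` factor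
`f : ℝ³ → [0, 1]` and the CROSS cut-off of two copies of `n + 1` particles `(X, Y)` (tags `x₀ = X 0`, `y₀ = Y 0`),
`φ(X, Y) = (∏ⱼ f(x₀ - yⱼ₊₁)) · ∏ⱼ f(y₀ - xⱼ₊₁)`, with the quadratic partition `sin(cφ)`, `cos(cφ)`:
the radial profile `f₀(y) = θ((|y| - R)/a)` (`θ = Torus.smoothCutProfile`) is a pair profile of radius `b = R + 2a`
vanishing on `|y| ≤ R + a`, and pair profiles have zero gradient beyond their radius and finite `∫|∇φ|²`, `∫(1 - φ²)`;
the gradient identity `|∇ sin(cψ)|² + |∇ cos(cψ)|² = c² |∇ψ|²` (one and two copies); the directional derivatives of the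
cross slice `F(X) = (∏ⱼ f(x₀ - pⱼ)) ∏ⱼ f(q - xⱼ₊₁)` — `|∂_{x₀} F| ≤ ∑ⱼ |∂f(x₀ - pⱼ)|`, `|∂_{xⱼ₊₁} F| ≤ |∂f(q - xⱼ₊₁)|` —
whence, by Cauchy–Schwarz over a set of `≤ P` indices carrying a non-zero gradient factor (supplied by hard-core packing
in part B), the POINTWISE GRADIENT BOUND `kinetic2 φ ≤ (P + 1) ∑ⱼ (|∇f|²(x₀ - yⱼ₊₁) + |∇f|²(y₀ - xⱼ₊₁))`
(`kinetic2_crossCutoff_le`); the MASS DEFICIT `|w cos(πφ/2)|² ≤ |w|² (∑ⱼ (1 - f(x₀ - yⱼ₊₁)²) + ∑ⱼ (1 - f(y₀ - xⱼ₊₁)²))`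
(Jordan's inequality, `1 ≤ ∏ tⱼ + ∑ (1 - tⱼ)`). Chain/product rules and `Real.mul_le_sin`; all folklore. Smoothness,
periodicity and the vanishing of the cross interaction are in part C1 (`…UpperFrameHardCorePointwise.lean`).
-/

noncomputable section

open MeasureTheory Filter
open scoped ENNReal NNReal BigOperators ComplexConjugate

namespace Summit.AtomisticToContinuum.BoseEinsteinCondensation.Cruxes.TorusHalfSwapOverlap.Birth

open Literature.MathematicalPhysics.QuantumManyBody.BoseGas
open Literature.Analysis.FunctionSpaces

/-! ### Helper lemmas (inside `namespace UpperFrameHardCoreCutoff … end UpperFrameHardCoreCutoff`) -/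

namespace UpperFrameHardCoreCutoff

/-! #### The radial profile `f₀(y) = θ((|y| - R)/a)` and pair profiles -/

/-- The smooth cross cut-off profile `f₀(y) = θ((|y| - R)/a)` vanishes on the closed ball of radius `R + a`.
[folklore] -/
theorem cut_eq_zero {a R : ℝ} (ha : 0 < a) {y : Space} (hy : ‖y‖ ≤ R + a) :
    Torus.smoothCutProfile ((‖y‖ - R) / a) = 0 := by
  obtain ⟨K, hK⟩ := Torus.exists_isCutProfile_smoothCutProfile
  exact hK.of_le_one _ (by rw [div_le_one ha]; linarith)

/-- The smooth cross cut-off profile `f₀(y) = θ((|y| - R)/a)` (`a > 0`, `R ≥ 0`) is a pair profile of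
radius `b = R + 2a`: `C¹`, even, `0 ≤ f₀ ≤ 1`, `f₀ = 1` beyond `b`. [folklore] -/
theorem isPairProfile_cut {a R : ℝ} (ha : 0 < a) (hR : 0 ≤ R) :
    IsPairProfile (R + 2 * a) fun y : Space => Torus.smoothCutProfile ((‖y‖ - R) / a) := by
  obtain ⟨K, hK⟩ := Torus.exists_isCutProfile_smoothCutProfile
  exact
    { contDiff := contDiff_smoothCutProfile_norm ha (by linarith)
      nonneg := fun y => hK.nonneg _
      le_one := fun y => hK.le_one _
      even := fun y => by rw [norm_neg]
      eq_one := fun y hy => hK.of_two_le _ (by rw [le_div_iff₀ ha]; linarith) }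

variable {b : ℝ} {φ : Space → ℝ}

/-- The gradient of a pair profile vanishes beyond its radius (every such point is a maximum). [folklore] -/
theorem _root_.Literature.MathematicalPhysics.QuantumManyBody.BoseGas.IsPairProfile.fderiv_eq_zero
    (hφ : IsPairProfile b φ) {z : Space} (hz : b ≤ ‖z‖) : fderiv ℝ φ z = 0 := by
  refine IsLocalMax.fderiv_eq_zero (Filter.Eventually.of_forall fun y => ?_)
  rw [hφ.eq_one z hz]
  exact hφ.le_one y

/-- `∫_{ℝ³} |∇φ|² < ∞` for a pair profile (continuous integrand supported in the ball of radius `b`). [folklore] -/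
theorem _root_.Literature.MathematicalPhysics.QuantumManyBody.BoseGas.IsPairProfile.lintegral_gradSq_lt_top
    (hφ : IsPairProfile b φ) : ∫⁻ x, gradSq φ x < ⊤ := by
  have hc : Continuous fun x => ‖gradVec φ x‖ ^ 2 := (continuous_gradVec hφ.contDiff).norm.pow 2
  have hs : HasCompactSupport fun x => ‖gradVec φ x‖ ^ 2 := by
    refine HasCompactSupport.intro (isCompact_closedBall (0 : Space) b) fun x hx => ?_
    rw [Metric.mem_closedBall, dist_zero_right, not_le] at hx
    have h0 : gradVec φ x = 0 := by
      ext k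
      simp [gradVec, hφ.fderiv_eq_zero hx.le]
    simp [h0]
  simp_rw [← ofReal_norm_gradVec_sq]
  exact (hc.integrable_of_hasCompactSupport hs).lintegral_lt_top

/-- `I = ∫_{ℝ³} (1 - φ²) < ∞` for a pair profile. [folklore] -/
theorem _root_.Literature.MathematicalPhysics.QuantumManyBody.BoseGas.IsPairProfile.profileDefect_lt_top
    (hφ : IsPairProfile b φ) : profileDefect φ < ⊤ := by
  have hc : Continuous fun x => 1 - φ x ^ 2 := continuous_const.sub (hφ.contDiff.continuous.pow 2)
  have hs : HasCompactSupport fun x => 1 - φ x ^ 2 := by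
    refine HasCompactSupport.intro (isCompact_closedBall (0 : Space) b) fun x hx => ?_
    rw [Metric.mem_closedBall, dist_zero_right, not_le] at hx
    simp [hφ.eq_one x hx.le]
  exact (hc.integrable_of_hasCompactSupport hs).lintegral_lt_top


/-! #### The quadratic partition `sin ∘ (c·ψ)`, `cos ∘ (c·ψ)`: gradient identity -/

/-- One direction: `|∂ sin(cψ)|² + |∂ cos(cψ)|² = c² |∂ψ|²` (chain rule, `sin² + cos² = 1`), the real
functions read in `ℂ`. [folklore] -/
theorem ennnorm_sq_fderiv_sin_add_cos {E : Type*} [NormedAddCommGroup E] [NormedSpace ℝ E]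
    {ψ : E → ℝ} {x : E} (hψ : DifferentiableAt ℝ ψ x) (c : ℝ) (d : E) :
    ((‖fderiv ℝ (fun y => (Real.sin (c * ψ y) : ℂ)) x d‖₊ : ℝ≥0∞)) ^ 2 +
        ((‖fderiv ℝ (fun y => (Real.cos (c * ψ y) : ℂ)) x d‖₊ : ℝ≥0∞)) ^ 2 =
      ENNReal.ofReal (c ^ 2) * ((‖fderiv ℝ (fun y => (ψ y : ℂ)) x d‖₊ : ℝ≥0∞)) ^ 2 := by
  have hcψ : HasFDerivAt (fun y => c * ψ y) (c • fderiv ℝ ψ x) x := hψ.hasFDerivAt.const_mul c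
  have hs : HasFDerivAt (fun y => (Real.sin (c * ψ y) : ℂ))
      (Complex.ofRealCLM.comp (Real.cos (c * ψ x) • (c • fderiv ℝ ψ x))) x :=
    Complex.ofRealCLM.hasFDerivAt.comp x hcψ.sin
  have hc' : HasFDerivAt (fun y => (Real.cos (c * ψ y) : ℂ))
      (Complex.ofRealCLM.comp (-Real.sin (c * ψ x) • (c • fderiv ℝ ψ x))) x :=
    Complex.ofRealCLM.hasFDerivAt.comp x hcψ.cos
  have hψ' : HasFDerivAt (fun y => (ψ y : ℂ)) (Complex.ofRealCLM.comp (fderiv ℝ ψ x)) x :=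
    Complex.ofRealCLM.hasFDerivAt.comp x hψ.hasFDerivAt
  rw [hs.fderiv, hc'.fderiv, hψ'.fderiv]
  simp only [ContinuousLinearMap.coe_comp, Function.comp_apply, _root_.smul_apply, smul_eq_mul,
    Complex.ofRealCLM_apply, ennnorm_real_sq]
  rw [← ENNReal.ofReal_add (sq_nonneg _) (sq_nonneg _), ← ENNReal.ofReal_mul (sq_nonneg _)]
  congr 1
  linear_combination (c * fderiv ℝ ψ x d) ^ 2 * Real.sin_sq_add_cos_sq (c * ψ x)

/-- One copy: `|∇ sin(cψ)|² + |∇ cos(cψ)|² = c² |∇ψ|²` pointwise (kinetic densities of the real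
functions read in `ℂ`). [folklore] -/
theorem kineticDensity_sin_add_cos {M : ℕ} {ψ : Config M → ℝ} {X : Config M}
    (hψ : DifferentiableAt ℝ ψ X) (c : ℝ) :
    kineticDensity (fun Y => (Real.sin (c * ψ Y) : ℂ)) X + kineticDensity (fun Y => (Real.cos (c * ψ Y) : ℂ)) X =
      ENNReal.ofReal (c ^ 2) * kineticDensity (fun Y => (ψ Y : ℂ)) X := by
  unfold kineticDensity
  simp only [Finset.mul_sum, ← Finset.sum_add_distrib]
  exact Finset.sum_congr rfl fun i _ => Finset.sum_congr rfl fun k _ =>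
    ennnorm_sq_fderiv_sin_add_cos hψ c _

/-- Two copies: `kinetic2 (sin(cφ)) + kinetic2 (cos(cφ)) = c² · kinetic2 φ` pointwise for `C¹` `φ`.
[folklore] -/
theorem kinetic2_sin_add_cos {n : ℕ} {φ : Config (n + 1) × Config (n + 1) → ℝ} (hφ : ContDiff ℝ 1 φ)
    (c : ℝ) (Z : Config (n + 1) × Config (n + 1)) :
    TwoCopyTorus.kinetic2 n (fun W => (Real.sin (c * φ W) : ℂ)) Z +
        TwoCopyTorus.kinetic2 n (fun W => (Real.cos (c * φ W) : ℂ)) Z =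
      ENNReal.ofReal (c ^ 2) * TwoCopyTorus.kinetic2 n (fun W => (φ W : ℂ)) Z := by
  have hX : DifferentiableAt ℝ (fun X => φ (X, Z.2)) Z.1 :=
    ((hφ.comp (contDiff_prodMk_left Z.2)).differentiable one_ne_zero) Z.1
  have hY : DifferentiableAt ℝ (fun Y => φ (Z.1, Y)) Z.2 :=
    ((hφ.comp (contDiff_prodMk_right Z.1)).differentiable one_ne_zero) Z.2
  have h1 := kineticDensity_sin_add_cos hX c
  have h2 := kineticDensity_sin_add_cos hY c
  simp only [TwoCopyTorus.kinetic2]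
  calc _ = (kineticDensity (fun Y => (Real.sin (c * φ (Y, Z.2)) : ℂ)) Z.1 +
        kineticDensity (fun Y => (Real.cos (c * φ (Y, Z.2)) : ℂ)) Z.1) +
      (kineticDensity (fun Y => (Real.sin (c * φ (Z.1, Y)) : ℂ)) Z.2 +
        kineticDensity (fun Y => (Real.cos (c * φ (Z.1, Y)) : ℂ)) Z.2) := by ring
    _ = _ := by rw [h1, h2, mul_add]

/-! #### The kinetic density of a real function -/

/-- `|∇(g : ℂ)|²(X) = ∑_{i,k} (∂_{i,k} g)²` for a real `g` differentiable at `X`. [folklore] -/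
theorem kineticDensity_ofReal {M : ℕ} {g : Config M → ℝ} {X : Config M} (hg : DifferentiableAt ℝ g X) :
    kineticDensity (fun Y => (g Y : ℂ)) X =
      ∑ i : Fin M, ∑ k : Fin 3,
        ENNReal.ofReal ((fderiv ℝ g X (Pi.single i (EuclideanSpace.single k (1 : ℝ)))) ^ 2) := by
  have h : HasFDerivAt (fun Y => (g Y : ℂ)) (Complex.ofRealCLM.comp (fderiv ℝ g X)) X :=
    Complex.ofRealCLM.hasFDerivAt.comp X hg.hasFDerivAt
  unfold kineticDensity
  simp only [h.fderiv, ContinuousLinearMap.coe_comp, Function.comp_apply, Complex.ofRealCLM_apply,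
    ennnorm_real_sq]

/-- `|∇g|²(y) = ∑ₖ (∂ₖ g)²` as `ofReal`. [folklore] -/
theorem gradSq_eq_sum_ofReal (g : Space → ℝ) (y : Space) :
    gradSq g y = ∑ k : Fin 3, ENNReal.ofReal ((fderiv ℝ g y (EuclideanSpace.single k (1 : ℝ))) ^ 2) := by
  unfold gradSq
  simp only [ennnorm_sq_real]

/-! #### Cauchy–Schwarz on the support -/

/-- `(∑_s u)² ≤ #t · ∑_s u²` when `u` vanishes on `s ∖ t`, `t ⊆ s`. [folklore] -/
theorem sq_sum_le_card_mul_sum_sq_of_subset {ι : Type*} {s t : Finset ι} (hts : t ⊆ s) (u : ι → ℝ)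
    (h0 : ∀ i ∈ s, i ∉ t → u i = 0) :
    (∑ i ∈ s, u i) ^ 2 ≤ (t.card : ℝ) * ∑ i ∈ s, u i ^ 2 := by
  rw [← Finset.sum_subset hts h0]
  exact (sq_sum_le_card_mul_sum_sq (s := t) (f := u)).trans (mul_le_mul_of_nonneg_left
    (Finset.sum_le_sum_of_subset_of_nonneg hts fun i _ _ => sq_nonneg _) (Nat.cast_nonneg _))

/-! #### Directional derivatives of the cross cut-off slice `F(X) = (∏ⱼ f(x₀ - pⱼ)) · ∏ⱼ f(q - xⱼ₊₁)` -/

variable {n : ℕ}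

/-- Products of `[0,1]`-valued factors are in `[0,1]`, hence of absolute value `≤ 1`. [folklore] -/
theorem abs_prod_le_one {ι : Type*} (s : Finset ι) {g : ι → ℝ} (h0 : ∀ i, 0 ≤ g i) (h1 : ∀ i, g i ≤ 1) :
    |∏ i ∈ s, g i| ≤ 1 := by
  rw [abs_of_nonneg (Finset.prod_nonneg fun i _ => h0 i)]
  exact Finset.prod_le_one (fun i _ => h0 i) fun i _ => h1 i

/-- The derivative of the cross cut-off slice (product rule). [folklore] -/
theorem hasFDerivAt_crossSlice {f : Space → ℝ} (hf : ContDiff ℝ 1 f) (p : Fin n → Space) (q : Space)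
    (X : Config (n + 1)) :
    HasFDerivAt (fun Y : Config (n + 1) => (∏ j : Fin n, f (Y 0 - p j)) * ∏ j : Fin n, f (q - Y j.succ))
      ((∏ j : Fin n, f (X 0 - p j)) •
          (∑ j : Fin n, (∏ j' ∈ Finset.univ.erase j, f (q - X j'.succ)) •
            (fderiv ℝ f (q - X j.succ)).comp
              (-(ContinuousLinearMap.proj (R := ℝ) (φ := fun _ : Fin (n + 1) => Space) j.succ))) +
        (∏ j : Fin n, f (q - X j.succ)) •
          (∑ j : Fin n, (∏ j' ∈ Finset.univ.erase j, f (X 0 - p j')) •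
            (fderiv ℝ f (X 0 - p j)).comp
              (ContinuousLinearMap.proj (R := ℝ) (φ := fun _ : Fin (n + 1) => Space) 0))) X := by
  have hd : ∀ y, HasFDerivAt f (fderiv ℝ f y) y := fun y => (hf.differentiable one_ne_zero y).hasFDerivAt
  have hA : HasFDerivAt (fun Y : Config (n + 1) => ∏ j : Fin n, f (Y 0 - p j))
      (∑ j : Fin n, (∏ j' ∈ Finset.univ.erase j, f (X 0 - p j')) •
        (fderiv ℝ f (X 0 - p j)).comp
          (ContinuousLinearMap.proj (R := ℝ) (φ := fun _ : Fin (n + 1) => Space) 0)) X :=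
    HasFDerivAt.finsetProd fun j _ => (hd _).comp X ((hasFDerivAt_apply 0 X).sub_const (p j))
  have hB : HasFDerivAt (fun Y : Config (n + 1) => ∏ j : Fin n, f (q - Y j.succ))
      (∑ j : Fin n, (∏ j' ∈ Finset.univ.erase j, f (q - X j'.succ)) •
        (fderiv ℝ f (q - X j.succ)).comp
          (-(ContinuousLinearMap.proj (R := ℝ) (φ := fun _ : Fin (n + 1) => Space) j.succ))) X :=
    HasFDerivAt.finsetProd fun j _ => (hd _).comp X ((hasFDerivAt_apply j.succ X).const_sub q)
  exact hA.mul hB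

/-- **Tagged direction**: `|∂_{x₀,e} F| ≤ ∑ⱼ |∂_e f(x₀ - pⱼ)|` for `[0,1]`-valued `f`. [folklore] -/
theorem norm_fderiv_crossSlice_zero_le {f : Space → ℝ} (hf : ContDiff ℝ 1 f) (h0 : ∀ y, 0 ≤ f y)
    (h1 : ∀ y, f y ≤ 1) (p : Fin n → Space) (q : Space) (X : Config (n + 1)) (e : Space) :
    ‖fderiv ℝ (fun Y : Config (n + 1) => (∏ j : Fin n, f (Y 0 - p j)) * ∏ j : Fin n, f (q - Y j.succ)) X (Pi.single 0 e)‖ ≤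
      ∑ j, ‖fderiv ℝ f (X 0 - p j) e‖ := by
  rw [(hasFDerivAt_crossSlice hf p q X).fderiv]
  simp only [_root_.add_apply, _root_.smul_apply, _root_.sum_apply, _root_.neg_apply,
    ContinuousLinearMap.coe_comp, Function.comp_apply, ContinuousLinearMap.proj_apply,
    Pi.single_eq_same, Pi.single_eq_of_ne (Fin.succ_ne_zero _), neg_zero, map_zero, smul_eq_mul, mul_zero,
    Finset.sum_const_zero, zero_add]
  rw [norm_mul, Real.norm_eq_abs]
  calc |∏ j : Fin n, f (q - X j.succ)| * ‖∑ j, (∏ j' ∈ Finset.univ.erase j, f (X 0 - p j')) * fderiv ℝ f (X 0 - p j) e‖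
      ≤ 1 * ∑ j, ‖(∏ j' ∈ Finset.univ.erase j, f (X 0 - p j')) * fderiv ℝ f (X 0 - p j) e‖ := by
        gcongr
        · exact abs_prod_le_one _ (fun _ => h0 _) (fun _ => h1 _)
        · exact norm_sum_le _ _
    _ ≤ 1 * ∑ j, ‖fderiv ℝ f (X 0 - p j) e‖ := by
        gcongr with j _
        rw [norm_mul]
        exact mul_le_of_le_one_left (norm_nonneg _) (abs_prod_le_one _ (fun _ => h0 _) (fun _ => h1 _))
    _ = _ := one_mul _

/-- **Bath direction**: `|∂_{xⱼ₊₁,e} F| ≤ |∂_e f(q - xⱼ₊₁)|` for `[0,1]`-valued `f`. [folklore] -/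
theorem norm_fderiv_crossSlice_succ_le {f : Space → ℝ} (hf : ContDiff ℝ 1 f) (h0 : ∀ y, 0 ≤ f y)
    (h1 : ∀ y, f y ≤ 1) (p : Fin n → Space) (q : Space) (X : Config (n + 1)) (j₀ : Fin n) (e : Space) :
    ‖fderiv ℝ (fun Y : Config (n + 1) => (∏ j : Fin n, f (Y 0 - p j)) * ∏ j : Fin n, f (q - Y j.succ)) X
        (Pi.single j₀.succ e)‖ ≤ ‖fderiv ℝ f (q - X j₀.succ) e‖ := by
  rw [(hasFDerivAt_crossSlice hf p q X).fderiv]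
  simp only [_root_.add_apply, _root_.smul_apply, _root_.sum_apply, _root_.neg_apply,
    ContinuousLinearMap.coe_comp, Function.comp_apply, ContinuousLinearMap.proj_apply,
    Pi.single_eq_of_ne (Fin.succ_ne_zero _).symm, map_zero, smul_eq_mul, mul_zero, Finset.sum_const_zero,
    add_zero]
  rw [Finset.sum_eq_single j₀ (fun j _ hj => by
      rw [Pi.single_eq_of_ne (fun h => hj (Fin.succ_injective _ h)), neg_zero, map_zero, mul_zero])
    (fun h => absurd (Finset.mem_univ j₀) h)]
  rw [Pi.single_eq_same, map_neg, norm_mul, norm_mul, norm_neg, ← mul_assoc]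
  refine mul_le_of_le_one_left (norm_nonneg _) ?_
  rw [Real.norm_eq_abs, Real.norm_eq_abs]
  exact mul_le_one₀ (abs_prod_le_one _ (fun _ => h0 _) (fun _ => h1 _)) (abs_nonneg _) (abs_prod_le_one _ (fun _ => h0 _) (fun _ => h1 _))

/-! #### The pointwise gradient bound of the cross cut-off -/

/-- **One copy**: if the indices `j` carrying a non-zero gradient `∇f(x₀ - pⱼ)` lie in a set `S` of size `≤ P`,
`|∇_X F|²(X) ≤ P ∑ⱼ |∇f|²(x₀ - pⱼ) + ∑ⱼ |∇f|²(q - xⱼ₊₁)` for the cross slice `F`. [folklore] -/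
theorem kineticDensity_crossSlice_le {f : Space → ℝ} (hf : ContDiff ℝ 1 f) (h0 : ∀ y, 0 ≤ f y)
    (h1 : ∀ y, f y ≤ 1) (p : Fin n → Space) (q : Space) (X : Config (n + 1)) {S : Finset (Fin n)}
    (hS : ∀ j, j ∉ S → fderiv ℝ f (X 0 - p j) = 0) {P : ℝ} (hP : (S.card : ℝ) ≤ P) :
    kineticDensity (fun Y : Config (n + 1) =>
        (((∏ j : Fin n, f (Y 0 - p j)) * ∏ j : Fin n, f (q - Y j.succ) : ℝ) : ℂ)) X ≤
      ENNReal.ofReal P * ∑ j : Fin n, gradSq f (X 0 - p j) + ∑ j : Fin n, gradSq f (q - X j.succ) := by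
  have hP0 : 0 ≤ P := (Nat.cast_nonneg _).trans hP
  have hF : DifferentiableAt ℝ
      (fun Y : Config (n + 1) => (∏ j : Fin n, f (Y 0 - p j)) * ∏ j : Fin n, f (q - Y j.succ)) X :=
    (hasFDerivAt_crossSlice hf p q X).differentiableAt
  rw [kineticDensity_ofReal hF, Fin.sum_univ_succ]
  refine add_le_add ?_ ?_
  · -- the tagged particle `x₀`: Cauchy–Schwarz over the `≤ P` active indices
    calc ∑ k : Fin 3, ENNReal.ofReal ((fderiv ℝ
            (fun Y : Config (n + 1) => (∏ j : Fin n, f (Y 0 - p j)) * ∏ j : Fin n, f (q - Y j.succ)) X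
              (Pi.single 0 (EuclideanSpace.single k (1 : ℝ)))) ^ 2)
        ≤ ∑ k : Fin 3, ENNReal.ofReal
            (P * ∑ j : Fin n, (fderiv ℝ f (X 0 - p j) (EuclideanSpace.single k (1 : ℝ))) ^ 2) := by
          refine Finset.sum_le_sum fun k _ => ENNReal.ofReal_le_ofReal ?_
          refine (sq_le_sq.2 (((Real.norm_eq_abs _).symm.trans_le
            (norm_fderiv_crossSlice_zero_le hf h0 h1 p q X _)).trans (le_abs_self _))).trans ?_
          refine (sq_sum_le_card_mul_sum_sq_of_subset (Finset.subset_univ S)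
            (fun j => ‖fderiv ℝ f (X 0 - p j) (EuclideanSpace.single k (1 : ℝ))‖) fun j _ hj => ?_).trans ?_
          · rw [hS j hj, _root_.zero_apply, norm_zero]
          · simp only [Real.norm_eq_abs, sq_abs]
            exact mul_le_mul_of_nonneg_right hP (Finset.sum_nonneg fun j _ => sq_nonneg _)
      _ = ENNReal.ofReal P * ∑ j : Fin n, gradSq f (X 0 - p j) := by
          simp_rw [ENNReal.ofReal_mul hP0, ENNReal.ofReal_sum_of_nonneg (fun j _ => sq_nonneg _),
            gradSq_eq_sum_ofReal, ← Finset.mul_sum]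
          rw [Finset.sum_comm]
  · -- the bath particles `xⱼ₊₁`
    simp_rw [gradSq_eq_sum_ofReal]
    refine Finset.sum_le_sum fun j _ => Finset.sum_le_sum fun k _ => ENNReal.ofReal_le_ofReal ?_
    rw [← sq_abs (fderiv ℝ f _ _), ← Real.norm_eq_abs]
    exact sq_le_sq.2 (((Real.norm_eq_abs _).symm.trans_le
      (norm_fderiv_crossSlice_succ_le hf h0 h1 p q X j _)).trans (le_abs_self _))

/-- **Two copies — the pointwise gradient bound of the cross cut-off**: if the bath particles of either copy
carrying a non-zero gradient factor against the other copy's tag lie in sets of size `≤ P`, then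
`kinetic2 φ (X, Y) ≤ (P + 1) ∑ⱼ (|∇f|²(x₀ - yⱼ₊₁) + |∇f|²(y₀ - xⱼ₊₁))`. [folklore] -/
theorem kinetic2_crossCutoff_le {f : Space → ℝ} (hf : ContDiff ℝ 1 f) (h0 : ∀ y, 0 ≤ f y) (h1 : ∀ y, f y ≤ 1)
    (Z : Config (n + 1) × Config (n + 1)) {SX SY : Finset (Fin n)}
    (hSX : ∀ j, j ∉ SX → fderiv ℝ f (Z.1 0 - Z.2 j.succ) = 0) (hSY : ∀ j, j ∉ SY → fderiv ℝ f (Z.2 0 - Z.1 j.succ) = 0)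
    {P : ℝ} (hPX : (SX.card : ℝ) ≤ P) (hPY : (SY.card : ℝ) ≤ P) :
    TwoCopyTorus.kinetic2 n (fun W =>
        (((∏ j : Fin n, f (W.1 0 - W.2 j.succ)) * ∏ j : Fin n, f (W.2 0 - W.1 j.succ) : ℝ) : ℂ)) Z ≤
      ENNReal.ofReal (P + 1) * ∑ j : Fin n, (gradSq f (Z.1 0 - Z.2 j.succ) + gradSq f (Z.2 0 - Z.1 j.succ)) := by
  have hP0 : 0 ≤ P := (Nat.cast_nonneg _).trans hPX
  have hX := kineticDensity_crossSlice_le hf h0 h1 (fun j => Z.2 j.succ) (Z.2 0) Z.1 hSX hPX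
  have hY := kineticDensity_crossSlice_le hf h0 h1 (fun j => Z.1 j.succ) (Z.1 0) Z.2 hSY hPY
  have hYfun : (fun Y : Config (n + 1) =>
      (((∏ j : Fin n, f (Z.1 0 - Y j.succ)) * ∏ j : Fin n, f (Y 0 - Z.1 j.succ) : ℝ) : ℂ)) =
      fun Y => (((∏ j : Fin n, f (Y 0 - Z.1 j.succ)) * ∏ j : Fin n, f (Z.1 0 - Y j.succ) : ℝ) : ℂ) :=
    funext fun Y => by rw [mul_comm]
  unfold TwoCopyTorus.kinetic2
  dsimp only
  rw [hYfun]
  refine (add_le_add hX hY).trans_eq ?_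
  rw [ENNReal.ofReal_add hP0 zero_le_one, ENNReal.ofReal_one, Finset.sum_add_distrib]
  ring

/-! #### The mass deficit of the quadratic partition -/

/-- Jordan: `cos²(πu/2) ≤ 1 - u²` for `u ∈ [0, 1]` (`u ≤ sin(πu/2)`, `Real.mul_le_sin`). [folklore] -/
theorem cos_sq_le {u : ℝ} (h0 : 0 ≤ u) (h1 : u ≤ 1) : Real.cos (Real.pi / 2 * u) ^ 2 ≤ 1 - u ^ 2 := by
  have hx0 : 0 ≤ Real.pi / 2 * u := by positivity
  have hx1 : Real.pi / 2 * u ≤ Real.pi / 2 := mul_le_of_le_one_right (by positivity) h1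
  have hsin : u ≤ Real.sin (Real.pi / 2 * u) := by
    have h := Real.mul_le_sin hx0 hx1
    rwa [← mul_assoc, show 2 / Real.pi * (Real.pi / 2) = 1 by field_simp, one_mul] at h
  rw [Real.cos_sq']
  nlinarith

/-- `1 - (∏ aⱼ · ∏ bⱼ)² ≤ ∑ (1 - aⱼ²) + ∑ (1 - bⱼ²)` for `[0,1]`-valued factors. [folklore] -/
theorem one_sub_prod_mul_prod_sq_le {ι : Type*} (s : Finset ι) {g h : ι → ℝ} (hg0 : ∀ i, 0 ≤ g i)
    (hg1 : ∀ i, g i ≤ 1) (hh0 : ∀ i, 0 ≤ h i) (hh1 : ∀ i, h i ≤ 1) :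
    1 - ((∏ i ∈ s, g i) * ∏ i ∈ s, h i) ^ 2 ≤ ∑ i ∈ s, (1 - g i ^ 2) + ∑ i ∈ s, (1 - h i ^ 2) := by
  have hsq1 : ∀ {t : ℝ}, 0 ≤ t → t ≤ 1 → t ^ 2 ≤ 1 := fun ht0 ht1 => pow_le_one₀ ht0 ht1
  have hA := one_le_prod_add_sum s (fun i => g i ^ 2) (fun i _ => sq_nonneg _) fun i _ => hsq1 (hg0 i) (hg1 i)
  have hB := one_le_prod_add_sum s (fun i => h i ^ 2) (fun i _ => sq_nonneg _) fun i _ => hsq1 (hh0 i) (hh1 i)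
  have hA1 : ∏ i ∈ s, g i ^ 2 ≤ 1 := Finset.prod_le_one (fun i _ => sq_nonneg _) fun i _ => hsq1 (hg0 i) (hg1 i)
  have hB1 : ∏ i ∈ s, h i ^ 2 ≤ 1 := Finset.prod_le_one (fun i _ => sq_nonneg _) fun i _ => hsq1 (hh0 i) (hh1 i)
  rw [mul_pow, ← Finset.prod_pow, ← Finset.prod_pow]
  nlinarith [mul_nonneg (sub_nonneg.2 hA1) (sub_nonneg.2 hB1)]

/-- **Pointwise mass deficit**: `|w cos(πφ/2)|² ≤ |w|² (∑ⱼ (1 - aⱼ²) + ∑ⱼ (1 - bⱼ²))` for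
`φ = ∏ aⱼ · ∏ bⱼ` with `[0,1]`-valued factors, in `ℝ≥0∞`. [folklore] -/
theorem ennnorm_sq_mul_cos_le {ι : Type*} (s : Finset ι) {g h : ι → ℝ} (hg0 : ∀ i, 0 ≤ g i)
    (hg1 : ∀ i, g i ≤ 1) (hh0 : ∀ i, 0 ≤ h i) (hh1 : ∀ i, h i ≤ 1) (w : ℂ) :
    ((‖w * (Real.cos (Real.pi / 2 * ((∏ i ∈ s, g i) * ∏ i ∈ s, h i)) : ℂ)‖₊ : ℝ≥0∞)) ^ 2 ≤
      ((‖w‖₊ : ℝ≥0∞)) ^ 2 *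
        (∑ i ∈ s, ENNReal.ofReal (1 - g i ^ 2) + ∑ i ∈ s, ENNReal.ofReal (1 - h i ^ 2)) := by
  have hφ0 : 0 ≤ (∏ i ∈ s, g i) * ∏ i ∈ s, h i :=
    mul_nonneg (Finset.prod_nonneg fun i _ => hg0 i) (Finset.prod_nonneg fun i _ => hh0 i)
  have hφ1 : (∏ i ∈ s, g i) * ∏ i ∈ s, h i ≤ 1 :=
    mul_le_one₀ (Finset.prod_le_one (fun i _ => hg0 i) fun i _ => hg1 i)
      (Finset.prod_nonneg fun i _ => hh0 i) (Finset.prod_le_one (fun i _ => hh0 i) fun i _ => hh1 i)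
  rw [ennnorm_mul_sq, ennnorm_real_sq,
    ← ENNReal.ofReal_sum_of_nonneg fun i _ => sub_nonneg.2 (pow_le_one₀ (hg0 i) (hg1 i)),
    ← ENNReal.ofReal_sum_of_nonneg fun i _ => sub_nonneg.2 (pow_le_one₀ (hh0 i) (hh1 i)),
    ← ENNReal.ofReal_add (Finset.sum_nonneg fun i _ => sub_nonneg.2 (pow_le_one₀ (hg0 i) (hg1 i)))
      (Finset.sum_nonneg fun i _ => sub_nonneg.2 (pow_le_one₀ (hh0 i) (hh1 i)))]
  gcongr
  exact (cos_sq_le hφ0 hφ1).trans (one_sub_prod_mul_prod_sq_le s hg0 hg1 hh0 hh1)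

end UpperFrameHardCoreCutoff

/-! ### The registered helper stub of part A -/

/-- Part A of `stub_upperFrameHardCore` (helper stub `stub_upperFrameHardCoreCutoff`, registered signature): **the
pointwise gradient bound of the cross cut-off** — if the bath particles of either copy carrying a non-zero gradient
factor against the other copy's tag lie in sets of size `≤ P`, then
`kinetic2 φ (X, Y) ≤ (P + 1) ∑ⱼ (|∇f|²(x₀ - yⱼ₊₁) + |∇f|²(y₀ - xⱼ₊₁))`. [folklore] -/
theorem stub_upperFrameHardCoreCutoff :
    ∀ (n : ℕ) (f : Space → ℝ), ContDiff ℝ 1 f → (∀ y, 0 ≤ f y) → (∀ y, f y ≤ 1) → ∀ (Z : Config (n + 1) × Config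
      (n + 1)) (SX SY : Finset (Fin n)) (P : ℝ), (∀ j, j ∉ SX → fderiv ℝ f (Z.1 0 - Z.2 j.succ) = 0) → (∀ j, j ∉
      SY → fderiv ℝ f (Z.2 0 - Z.1 j.succ) = 0) → (SX.card : ℝ) ≤ P → (SY.card : ℝ) ≤ P → TwoCopyTorus.kinetic2
      n (fun W => (((∏ j : Fin n, f (W.1 0 - W.2 j.succ)) * ∏ j : Fin n, f (W.2 0 - W.1 j.succ) : ℝ) : ℂ)) Z ≤
      ENNReal.ofReal (P + 1) * ∑ j : Fin n, (gradSq f (Z.1 0 - Z.2 j.succ) + gradSq f (Z.2 0 - Z.1 j.succ)) :=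
  fun _ _ hf h0 h1 Z _ _ _ hSX hSY hPX hPY => UpperFrameHardCoreCutoff.kinetic2_crossCutoff_le hf h0 h1 Z hSX hSY hPX hPY

end Summit.AtomisticToContinuum.BoseEinsteinCondensation.Cruxes.TorusHalfSwapOverlap.Birth

end
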